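import Summits.Ventures.Crystal3D.Theorems.StickyWulffConstantPolycrystalWulffBoundExteriorCrossSums
import Literature.Analysis.Convexity.AnisotropicIsoperimetric

/-!
# `PolycrystalWulffBound`: the free energy of a polyhedral texture dominates `r · Per(E)`;
# the wall identity `Σ_{f≠g} ι_B(G_f, G_g) = Σ_f Per(G_f) − Per(E)`

Route `StickyWulffConstant` of the venture `Summits/Ventures/Crystal3D`, crux `PolycrystalWulffBound`
(item `stmt-Ventures-19482`), second prover lane (poly-p2).  Set-level consequences of the exterior
cross sums (`exists_exterior_crossSums`) for a texture of pairwise disjoint polyhedral grains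
`G : Fin n → Set E3` of finite volume, `E = ⋃ f, G f`:

* `freeEnergy_ge_mul_perimeter` — for origin-symmetric compact convex bodies `K_f ⊇ B̄(0, r)`,
  `Σ_f [per K_f (G f) − Σ_{g ≠ f} ι_{K_f}(G f, G g)] ≥ r · Per(E)`
  (each grain's free energy is half its `K_f`-cross sum with the exterior cells, cross sums are
  monotone in the body, and the `B̄(0,r)`-cross sums of all grains add up to `2·Per_{B̄(0,r)}(E)`);
  with the crux's Wulff bodies `W_{A f} ⊇ B̄(0, √3)` this is «free energy ≥ √3 · Per(E)»;
* `sum_iota_eq_sum_per_sub_per` — `Σ_f Σ_{g≠f} ι_K(G f, G g) = Σ_f per K (G f) − per K E` for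
  origin-symmetric `K` (each wall facet is counted by two grains, each free facet by one);
* `iota_nonneg_of_poly` — `ι_K(G f, G g) ≥ 0`;
* `isoperimetric_toReal_three` — `3·(4π/3)^{1/3}·|G|^{2/3} ≤ Per(G)` (real form of the tree's
  `isoperimetric_inequality_perimeter`, `n = 3`), `isoConst_three_pos/_cube`;
* `texture_union_facts` (the union of a texture is measurable, of finite volume and perimeter, `|E| = Σ|G f|`),
  `per_closedBall_eq_mul_perimeter`, `neg_cruxWulffBody_eq` (the crux's Wulff body is origin-symmetric),
  `sum_ite_eq_sum_erase_div_two` (the crux's `Σ_g if f = g then 0 else …` bookkeeping).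
These are the two inputs «Fr ≥ √3·F» and «Σ P_f ≤ F + 2 S» of the corner rungs `rung_wallRich`,
`rung_fineTwinFree` (cf-p1 P-LINE §3; arithmetic `wallRich_arith` / `fine_pincer_arith`, gen 0).
WHAT THIS IS NOT: a result on grains in contact beyond the corner rungs; the crux is not claimed.
-/

noncomputable section

namespace Summit.Ventures.Crystal3D.Theorems

open MeasureTheory Set Metric
open scoped RealInnerProductSpace ENNReal Pointwise
open Summit.Ventures.Crystal3D.Cruxes.TextureLiminf.TexShadow
open Literature.Analysis.Convexity
open Literature.MathematicalPhysics.StatisticalMechanics (perimeter fccStacking)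

/-! ### Small bookkeeping lemmas -/

/-- `per (B̄(0, r)) S = r · Per(S)` for `r > 0`. -/
theorem per_closedBall_eq_mul_perimeter {r : ℝ} (hr : 0 < r) (S : Set E3) :
    per (closedBall (0 : E3) r) S = r * (perimeter S).toReal := by
  have hle := mul_perimeter_le_anisotropicPerimeter hr subset_rfl S
  have hge := anisotropicPerimeter_le_mul_perimeter hr subset_rfl S
  unfold per
  rw [perK_eq_anisotropicPerimeter, le_antisymm hge hle, ENNReal.toReal_mul, ENNReal.toReal_ofReal hr.le]

/-- The crux's bookkeeping `Σ_g (if f = g then 0 else X g / 2)` is `(Σ_{g ∈ univ.erase f} X g) / 2`. -/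
theorem sum_ite_eq_sum_erase_div_two {n : ℕ} (f : Fin n) (X : Fin n → ℝ) :
    (∑ g, (if f = g then 0 else X g / 2)) = (∑ g ∈ Finset.univ.erase f, X g) / 2 := by
  rw [← Finset.add_sum_erase _ _ (Finset.mem_univ f), if_pos rfl, zero_add, Finset.sum_div]
  refine Finset.sum_congr rfl fun g hg => ?_
  rw [if_neg (fun h => (Finset.mem_erase.1 hg).1 h.symm)]

/-- The crux's Wulff body `W_A = {y | ∀ ν, ⟪y, ν⟫ ≤ Φ(A⁻¹ν)}` is origin-symmetric (`Φ` is even). -/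
theorem neg_cruxWulffBody_eq (A : E3 ≃ₗᵢ[ℝ] E3) :
    -{y : E3 | ∀ ν : E3, ⟪y, ν⟫ ≤ Real.sqrt 2 / 4 *
        ∑ᶠ w ∈ {w | w ∈ fccStacking 1 (Real.sqrt (2 / 3)) ∧ ‖w‖ = 1}, |⟪w, A.symm ν⟫|} =
      {y : E3 | ∀ ν : E3, ⟪y, ν⟫ ≤ Real.sqrt 2 / 4 *
        ∑ᶠ w ∈ {w | w ∈ fccStacking 1 (Real.sqrt (2 / 3)) ∧ ‖w‖ = 1}, |⟪w, A.symm ν⟫|} := by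
  ext y
  simp only [Set.mem_neg, mem_setOf_eq]
  constructor
  · intro h ν
    have h' := h (-ν)
    rw [inner_neg_left, inner_neg_right, neg_neg, map_neg] at h'
    simp_rw [inner_neg_right, abs_neg] at h'
    exact h'
  · intro h ν
    have h' := h (-ν)
    rw [inner_neg_right, map_neg] at h'
    simp_rw [inner_neg_right, abs_neg] at h'
    rw [inner_neg_left]
    exact h'

/-! ### The isoperimetric inequality in real form (`n = 3`) -/

/-- The isoperimetric constant `3 · (4π/3)^{1/3}` is positive. -/
theorem isoConst_three_pos : 0 < 3 * (Real.pi * 4 / 3) ^ ((1 : ℝ) / 3) := by positivity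

/-- `(3 · (4π/3)^{1/3})³ = 36 π`. -/
theorem isoConst_three_cube : (3 * (Real.pi * 4 / 3) ^ ((1 : ℝ) / 3)) ^ 3 = 36 * Real.pi := by
  rw [mul_pow, ← Real.rpow_mul_natCast (by positivity)]
  norm_num
  ring

/-- **Isoperimetric inequality, real form in `ℝ³`:** for a measurable `G` of finite volume and
finite perimeter, `3 · (4π/3)^{1/3} · |G|^{2/3} ≤ Per(G)`. -/
theorem isoperimetric_toReal_three {G : Set E3} (hG : MeasurableSet G) (hv : volume G < ⊤)
    (hp : perimeter G ≠ ⊤) :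
    3 * (Real.pi * 4 / 3) ^ ((1 : ℝ) / 3) * (volume G).toReal ^ ((2 : ℝ) / 3) ≤
      (perimeter G).toReal := by
  have h := isoperimetric_inequality_perimeter (n := 3) (by norm_num) hG hv
  set V : ℝ := (volume G).toReal with hV
  have hV0 : 0 ≤ V := ENNReal.toReal_nonneg
  have hvolG : volume G = ENNReal.ofReal V := (ENNReal.ofReal_toReal hv.ne).symm
  have hball : volume (closedBall (0 : E3) 1) = ENNReal.ofReal (Real.pi * 4 / 3) := by
    rw [EuclideanSpace.volume_closedBall_fin_three]; simp
  have hexp : ((3 : ℕ) : ℝ)⁻¹ = (1 : ℝ) / 3 := by norm_num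
  rw [hball, hvolG, Nat.cast_ofNat, hexp,
    ENNReal.ofReal_rpow_of_nonneg (by positivity) (by norm_num),
    ENNReal.ofReal_rpow_of_nonneg hV0 (by norm_num),
    show (3 : ℝ≥0∞) = ENNReal.ofReal 3 by norm_num, ← ENNReal.ofReal_mul (by norm_num),
    ← ENNReal.ofReal_pow (Real.rpow_nonneg hV0 _), ← ENNReal.ofReal_mul (by positivity)] at h
  have h' := (ENNReal.ofReal_le_iff_le_toReal hp).1 h
  have hpow : (V ^ ((1 : ℝ) / 3)) ^ (3 - 1) = V ^ ((2 : ℝ) / 3) := by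
    rw [show (3 - 1 : ℕ) = 2 from rfl, ← Real.rpow_mul_natCast hV0]
    norm_num
  rw [hpow] at h'
  exact h'


/-! ### The union of a texture: measurable, finite volume, finite perimeter -/

/-- For pairwise disjoint grains of finite perimeter and finite volume, the union `E = ⋃ f, G f` is
measurable, has finite volume and finite perimeter, and `|E| = Σ_f |G f|`. -/
theorem texture_union_facts {n : ℕ} (G : Fin n → Set E3)
    (hfin : ∀ f, Literature.MathematicalPhysics.StatisticalMechanics.HasFinitePerimeter (G f) ∧
      volume (G f) < ⊤)
    (hdisj : ∀ f g, f ≠ g → Disjoint (G f) (G g)) :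
    MeasurableSet (⋃ f, G f) ∧ volume (⋃ f, G f) < ⊤ ∧ perimeter (⋃ f, G f) ≠ ⊤ ∧
      (volume (⋃ f, G f)).toReal = ∑ f, (volume (G f)).toReal := by
  have hm : ∀ f, MeasurableSet (G f) := fun f => (hfin f).1.1
  have hU : volume (⋃ f, G f) = ∑ f, volume (G f) := by
    rw [measure_iUnion (fun f g hfg => hdisj f g hfg) hm, tsum_fintype]
  refine ⟨MeasurableSet.iUnion hm, ?_, ?_, ?_⟩
  · rw [hU]; exact ENNReal.sum_lt_top.2 fun f _ => (hfin f).2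
  · refine ne_top_of_le_ne_top ?_ (perimeter_eq_anisotropicPerimeter_closedBall (⋃ f, G f) ▸
      anisotropicPerimeter_iUnion_le_sum _ hm fun f g hfg => hdisj f g hfg)
    refine ENNReal.sum_ne_top.2 fun f _ => ?_
    rw [← perimeter_eq_anisotropicPerimeter_closedBall]
    exact (hfin f).1.2.ne
  · rw [hU, ENNReal.toReal_sum fun f _ => (hfin f).2.ne]

/-! ### Free energy ≥ r · Per(E); the wall identity -/

/-- **The interface term of two polyhedral grains is nonnegative** (every compact convex `K ∋ 0`):
`0 ≤ per K (G f) + per K (G g) − per K (G f ∪ G g)` — it is a cross-cell facet sum. -/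
theorem iota_nonneg_of_poly {n : ℕ} (G : Fin n → Set E3)
    (hPoly : ∀ f, ∃ (k : ℕ) (H : Fin k → Finset (E3 × ℝ)), G f = ⋃ i, polytope (H i))
    (hvol : ∀ f, volume (G f) < ⊤) (hdisjG : ∀ f g, f ≠ g → Disjoint (G f) (G g))
    {K : Set E3} (hK : IsCompact K) (hKc : Convex ℝ K) (h0 : (0 : E3) ∈ K)
    {f g : Fin n} (hfg : f ≠ g) :
    0 ≤ per K (G f) + per K (G g) - per K (G f ∪ G g) := by
  obtain ⟨k, H, ν, S, SX, hwall, -, -⟩ := exists_exterior_crossSums G hPoly hvol hdisjG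
  rw [hwall K hK hKc h0 f g hfg]
  exact crossSum_nonneg hK h0 H ν (S f) (S g)

/-- **Free energy dominates `r · Per(E)`.**  For pairwise disjoint polyhedral grains of finite volume
and origin-symmetric compact convex bodies `K_f ∋ 0` with `B̄(0, r) ⊆ K_f` (`r > 0`):
`r · Per(⋃ f, G f) ≤ Σ_f [per K_f (G f) − Σ_g (if f = g then 0 else ι_{K_f}(G f, G g))]`,
`ι_K(S₁, S₂) = (per K S₁ + per K S₂ − per K (S₁ ∪ S₂))/2`. -/
theorem freeEnergy_ge_mul_perimeter {n : ℕ} (G : Fin n → Set E3)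
    (hPoly : ∀ f, ∃ (k : ℕ) (H : Fin k → Finset (E3 × ℝ)), G f = ⋃ i, polytope (H i))
    (hvol : ∀ f, volume (G f) < ⊤) (hdisjG : ∀ f g, f ≠ g → Disjoint (G f) (G g))
    (Kf : Fin n → Set E3) (hKc : ∀ f, IsCompact (Kf f)) (hKv : ∀ f, Convex ℝ (Kf f))
    (hK0 : ∀ f, (0 : E3) ∈ Kf f) (hKs : ∀ f, -Kf f = Kf f) {r : ℝ} (hr : 0 < r)
    (hball : ∀ f, closedBall (0 : E3) r ⊆ Kf f) :
    r * (perimeter (⋃ f, G f)).toReal ≤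
      ∑ f, (per (Kf f) (G f) - ∑ g, (if f = g then 0 else
        (per (Kf f) (G f) + per (Kf f) (G g) - per (Kf f) (G f ∪ G g)) / 2)) := by
  obtain ⟨k, H, ν, S, SX, hwall, hext, htot⟩ := exists_exterior_crossSums G hPoly hvol hdisjG
  -- the cross kernel, abbreviated
  set X : Set E3 → Fin k → Fin k → ℝ := fun K a b =>
    (if a < b then (supportFn K (ν a b) + supportFn K (-ν a b)) *
        facetArea (closure (polytope (H a)) ∩ closure (polytope (H b))) (ν a b)
      else (supportFn K (ν b a) + supportFn K (-ν b a)) *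
        facetArea (closure (polytope (H b)) ∩ closure (polytope (H a))) (ν b a)) with hX
  set B : Set E3 := closedBall (0 : E3) r with hB
  have hBc : IsCompact B := isCompact_closedBall 0 r
  have hBv : Convex ℝ B := convex_closedBall 0 r
  have hB0 : (0 : E3) ∈ B := mem_closedBall_self hr.le
  have hBs : -B = B := by rw [hB, neg_closedBall, neg_zero]
  have hBne : B.Nonempty := ⟨0, hB0⟩
  -- each grain: free energy = half the cross sum with the exterior cells
  have hf : ∀ f, per (Kf f) (G f) - ∑ g, (if f = g then 0 else
      (per (Kf f) (G f) + per (Kf f) (G g) - per (Kf f) (G f ∪ G g)) / 2) =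
      (∑ a ∈ S f, ∑ b ∈ SX, X (Kf f) a b) / 2 := by
    intro f
    have h : 2 * per (Kf f) (G f) = (∑ g ∈ Finset.univ.erase f,
        (per (Kf f) (G f) + per (Kf f) (G g) - per (Kf f) (G f ∪ G g))) +
        ∑ a ∈ S f, ∑ b ∈ SX, X (Kf f) a b := hext (Kf f) (hKc f) (hKv f) (hK0 f) (hKs f) f
    rw [sum_ite_eq_sum_erase_div_two]
    linarith
  -- monotonicity of the cross sums in the body
  have hmono : ∀ f, (∑ a ∈ S f, ∑ b ∈ SX, X B a b) ≤ ∑ a ∈ S f, ∑ b ∈ SX, X (Kf f) a b :=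
    fun f => crossSum_mono (hball f) (hKc f).isBounded hBne H ν (S f) SX
  -- the ball cross sums add up to `2 per B E = 2 r Per(E)`
  have ht : 2 * per B (⋃ f, G f) = ∑ f, ∑ a ∈ S f, ∑ b ∈ SX, X B a b := htot B hBc hBv hB0 hBs
  calc r * (perimeter (⋃ f, G f)).toReal = per B (⋃ f, G f) :=
        (per_closedBall_eq_mul_perimeter hr _).symm
    _ = ∑ f, (∑ a ∈ S f, ∑ b ∈ SX, X B a b) / 2 := by rw [← Finset.sum_div]; linarith
    _ ≤ ∑ f, (∑ a ∈ S f, ∑ b ∈ SX, X (Kf f) a b) / 2 :=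
        Finset.sum_le_sum fun f _ => div_le_div_of_nonneg_right (hmono f) zero_le_two
    _ = _ := Finset.sum_congr rfl fun f _ => (hf f).symm

/-- **Wall identity.**  For pairwise disjoint polyhedral grains of finite volume and an
origin-symmetric compact convex body `K ∋ 0`:
`Σ_f Σ_g (if f = g then 0 else ι_K(G f, G g)) = Σ_f per K (G f) − per K (⋃ f, G f)`
(each wall facet is counted by both grains, each free facet by one). -/
theorem sum_iota_eq_sum_per_sub_per {n : ℕ} (G : Fin n → Set E3)
    (hPoly : ∀ f, ∃ (k : ℕ) (H : Fin k → Finset (E3 × ℝ)), G f = ⋃ i, polytope (H i))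
    (hvol : ∀ f, volume (G f) < ⊤) (hdisjG : ∀ f g, f ≠ g → Disjoint (G f) (G g))
    {K : Set E3} (hK : IsCompact K) (hKc : Convex ℝ K) (h0 : (0 : E3) ∈ K) (hKs : -K = K) :
    (∑ f, ∑ g, (if f = g then 0 else (per K (G f) + per K (G g) - per K (G f ∪ G g)) / 2)) =
      (∑ f, per K (G f)) - per K (⋃ f, G f) := by
  obtain ⟨k, H, ν, S, SX, hwall, hext, htot⟩ := exists_exterior_crossSums G hPoly hvol hdisjG
  set X : Fin k → Fin k → ℝ := fun a b =>
    (if a < b then (supportFn K (ν a b) + supportFn K (-ν a b)) *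
        facetArea (closure (polytope (H a)) ∩ closure (polytope (H b))) (ν a b)
      else (supportFn K (ν b a) + supportFn K (-ν b a)) *
        facetArea (closure (polytope (H b)) ∩ closure (polytope (H a))) (ν b a)) with hX
  have hf : ∀ f, (∑ g, (if f = g then 0 else (per K (G f) + per K (G g) - per K (G f ∪ G g)) / 2))
      = per K (G f) - (∑ a ∈ S f, ∑ b ∈ SX, X a b) / 2 := by
    intro f
    have h : 2 * per K (G f) = (∑ g ∈ Finset.univ.erase f,
        (per K (G f) + per K (G g) - per K (G f ∪ G g))) + ∑ a ∈ S f, ∑ b ∈ SX, X a b :=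
      hext K hK hKc h0 hKs f
    rw [sum_ite_eq_sum_erase_div_two]
    linarith
  have ht : 2 * per K (⋃ f, G f) = ∑ f, ∑ a ∈ S f, ∑ b ∈ SX, X a b := htot K hK hKc h0 hKs
  rw [Finset.sum_congr rfl fun f _ => hf f, Finset.sum_sub_distrib, ← Finset.sum_div]
  linarith

end Summit.Ventures.Crystal3D.Theorems

end
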